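import Literature.MathematicalPhysics.QuantumFieldTheory.Balaban1983to89.B9Eq3194Derivative
import Literature.MathematicalPhysics.QuantumFieldTheory.Balaban1983to89.B7Eq208Analytic

/-!
# `Balaban1983to89.B9Eq3193Analytic` — T. Bałaban, *Propagators for lattice gauge theories in a background field*, Commun.
Math. Phys. **99** (1985) 389–434 [Balaban1985BackgroundPropagators], Appendix p. 433, display (3.193): the non-linear chiral
average `Q_j(U, A) = (1/i) log Ũ′ʲ` IS ANALYTIC IN `A` («expanding in A …») — the analyticity of [Balaban1985Averaging] (208)
p. 50 specialised to the external field `U₀ = 1` and the chiral family `e^{iA}U`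

statement-level skeleton of published theorems with citation tags; proofs where landed; nothing here is a claim about the Yang–Mills mass gap

PDF held: `paper:balaban1985-cmp99-background-propagators` (journal page = PDF page + 388); p. 433 [PDF 45] read on the render
`b2b-balaban-ref1/pages/1985-cmp99-background-propagators/…-p045-x2.png` AS AN IMAGE (this seat, 2026-08-21); [5] = [Balaban1985Averaging]
p. 50 quoted verbatim in `B7Eq208Analytic`.

CITATION HEADER (lean-in-tree rule).  Cell `lit-balaban` (HOME `run/shared/lean/pub/lit-balaban/`), PHASE-2 proof seat `lit-balaban-p05`
(gen 4; TAKING line HOME/STATUS.md 2026-08-21T06:14:40Z) — KERNEL PIECE for SKELETON row **`B9.App`** (Appendix (3.188)–(3.194);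
owner `lit-balaban-r06`, referee ref-4), display **(3.193)** (r06's `B9AppChiral.Qj`, «typed (def with body)»), companion of this seat's
(3.194) files `B9Eq3194Derivative` / `B9Eq3194LinearTerm` / `B9Eq3194Smallness` (the LINEAR TERM of the expansion in `A` and its
smallness).  ENGINE: r04's `B7Eq208Analytic` ((208) of [5]: the averages (78)–(80) of analytic unit-valued families are analytic,
`analyticAt_uavg_family`), read at the external field `U₀ = 1`.

PRINT (p. 433 [PDF 45], verbatim): *"Taking `Q_j(U, A) = (1/i) log Ũ′ʲ = (1/i) log (U′U)‾ʲ (Ūʲ)⁻¹` (3.193) and expanding in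
`A`, we can easily see that for the linear term we have `Q_j(U)A = Q′_jA + F_{2,j}(U)A`, (3.194) where the operator `F_{2,j}(U)` is
small."*  Here `U′ = e^{iA}` and the bars are the averaging operations (78)–(80) of [5] at the external field `1` (r06's reading in
`B9AppChiral`: `Qj L U A j y = I⁻¹ • log ((e^{iA}U)‾ʲ(y)·(Ūʲ(y))⁻¹)`, `‾ʲ = B7Eq84Concrete.uavg L 1 · j`).  [5] p. 50: *"It is obvious
from the definition of the averaging operations that `ũ′ʲ` are analytic functions of `λ` …"* (208).

WHAT THIS FILE PROVES (kernel, no `sorry`, standard axioms; THEOREMS ONLY).  «Expanding in A» presupposes that `A ↦ Q_j(U, A)(y)` is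
analytic; this file makes that a kernel theorem for the concrete objects, in the reading of `B7Eq208Analytic` (R1): complex-analytic
(`AnalyticAt ℂ`) in a parameter `t` of ANY complex normed space `E` on which `A = Λ(t)` depends analytically sitewise.
* §1 `analyticAt_uavg_one` — r04's `B7Eq208Analytic.analyticAt_uavg_family` at the external field `U₀ = 1`, with its loop hypothesis
  rewritten as this seat's `B9Eq3194Derivative.LogDom` (`R(1(Γ)) = id`): for a sitewise-analytic unit-valued family `G(t)` with
  `LogDom L (G t₀) j`, every `t ↦ (G(t))‾ˡ(y)`, `l ≤ j`, and its inverse are analytic at `t₀`.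
* §2 `analyticAt_site_pert`, `analyticAt_uavg_pert` — the chiral family `e^{iΛ(t)}U` of (3.193) is sitewise analytic, hence so are its
  averages `(e^{iΛ(t)}U)‾ˡ(y)` under `LogDom L (e^{iΛ(t₀)}U) j`.
* §3 **`analyticAt_Qj_family`** — `t ↦ Q_j(U, Λ(t))(y)` is analytic at every `t₀` with `LogDom L (e^{iΛ(t₀)}U) j` and the ratio
  `(e^{iΛ(t₀)}U)‾ʲ(y)(Ūʲ(y))⁻¹` in the disc `|W − 1| < 1` of the series logarithm (21) (`MatrixLog.analyticAt_mlog`).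
  **`analyticAt_Qj_of_eq_zero`** — AROUND `A = 0` (the expansion point of (3.194)): if `Λ(t₀) = 0`, then `LogDom L U j` ALONE (the
  hypothesis of `B9Eq3194Derivative.hasDerivAt_Qj`; the ratio is `1` at `t₀`) gives analyticity at `t₀`; **`analyticAt_Qj_smul_zero`** —
  the complex line `t ↦ Q_j(U, tA)(y)` of `hasDerivAt_Qj` is analytic at `t = 0` (so (3.194)'s `Q_j(U)A = linQj L U A j y` is the first
  Taylor coefficient of an analytic germ); `analyticAt_Qj_smul_zero_of_cond167` — the same under the (167)-regularity
  `Cond167 L 1 U j α η`, `αLʲη < 1` of `B9Eq3194Smallness.norm_F2_le`.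
READINGS.  (R1) «analytic in A» = `AnalyticAt ℂ` along analytic parametrisations `Λ : E → (Site d → 𝔸)` (the cell's standing reading:
`B7Prop3GeneralAnalytic`, `B7Prop6GeneralAnalytic`, `B7Prop7OneStepAnalytic`, `B7Eq208Analytic`); the site lattice `ℤᵈ` being infinite,
`A` itself does not range over a normed space, and every `Q_j(U, A)(y)` depends on finitely many `A(x)` only.  (R2) `𝔸` is any
complete normed `ℂ`-algebra; `U` arbitrary units (no unitarity, no smallness of `U − 1`: a CHIRAL background).
DECLARATIONS: theorems only.  Unit `lit-balaban-p05` (gen 4), 2026-08-21.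
[cite: Balaban1985BackgroundPropagators, (3.193)–(3.194) p.433; Balaban1985Averaging, (208) p.50, (78)–(80) p.30]
-/

noncomputable section

open NormedSpace Finset Complex

namespace Literature.MathematicalPhysics.QuantumFieldTheory.Balaban1983to89.B9Eq3193Analytic

open B7Prop1Explicit MatrixLog B7Eq99Concrete B7Eq84Concrete B7Eq92Concrete
open B7Eq167Flat (Cond167)
open B7Prop8Flat (expUnit_zero)
open B8Ineq130 (hol_one)
open B9AppChiral (Qj Qj_apply)
open B9Eq3194Derivative (LogDom Wr Wr_apply logDom_of_cond167)
open B7Eq208Analytic (analyticAt_uavg_family)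

-- `Site` alone would resolve to the torus sites of `Setup.lean`; re-export the `ℤ^d` sites of `B7Prop1Explicit`.
export B7Prop1Explicit (Site)

variable {d : ℕ}
variable {𝔸 : Type*} [NormedRing 𝔸] [NormedAlgebra ℂ 𝔸] [CompleteSpace 𝔸]
variable {E : Type*} [NormedAddCommGroup E] [NormedSpace ℂ E]
variable (L : ℕ)

/-! ## §1 The averages (79)–(80) at the external field `1` along an analytic family -/

/-- **(79)–(80) of [5] at the external field `U₀ = 1`, along an analytic family** (r04's `B7Eq208Analytic.analyticAt_uavg_family`
with `R(1(Γ_{y,x})) = id`): for a sitewise-analytic unit-valued family `t ↦ G(t)` (values and inverses analytic at `t₀`) whose member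
at `t₀` satisfies the log-domain condition `LogDom L (G t₀) j` (`|((G‾ˡ)(Lz))⁻¹(G‾ˡ)(Lz + r) − 1| < 1`, `l < j`), every average
`t ↦ (G(t))‾ˡ(y)`, `l ≤ j`, and its inverse are analytic at `t₀`.
[cite: Balaban1985Averaging, (79)–(80) p.30, (208) p.50; Balaban1985BackgroundPropagators, (3.193) p.433] -/
theorem analyticAt_uavg_one {G : E → Site d → 𝔸ˣ} {t₀ : E}
    (hG : ∀ x : Site d, AnalyticAt ℂ (fun t => ((G t x : 𝔸ˣ) : 𝔸)) t₀ ∧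
      AnalyticAt ℂ (fun t => (((G t x)⁻¹ : 𝔸ˣ) : 𝔸)) t₀)
    {j : ℕ} (hdom : LogDom L (G t₀) j) :
    ∀ l ≤ j, ∀ y : Site d,
      AnalyticAt ℂ (fun t => ((uavg L 1 (G t) l y : 𝔸ˣ) : 𝔸)) t₀ ∧
        AnalyticAt ℂ (fun t => (((uavg L 1 (G t) l y)⁻¹ : 𝔸ˣ) : 𝔸)) t₀ :=
  analyticAt_uavg_family L 1 hG j (fun l hl z r => by
    simpa only [avgIter_one, hol_one, Rc_one_apply, Wr_apply] using hdom l hl z r)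

/-! ## §2 The chiral family `e^{iΛ(t)}U` of (3.193) -/

/-- The chiral family `x ↦ e^{iΛ(t)(x)}U(x)` (print's `U′U`, `U′ = e^{iA}`, `A = Λ(t)`) and its inverse are sitewise analytic in `t`
(`exp` is entire, `NormedSpace.exp_analytic`; `U` fixed, arbitrary units). [cite: Balaban1985BackgroundPropagators, (3.193) p.433] -/
theorem analyticAt_site_pert {Λ : E → Site d → 𝔸} {t₀ : E} (hΛ : ∀ x : Site d, AnalyticAt ℂ (fun t => Λ t x) t₀)
    (U : Site d → 𝔸ˣ) (x : Site d) :
    AnalyticAt ℂ (fun t => ((expUnit (I • Λ t x) * U x : 𝔸ˣ) : 𝔸)) t₀ ∧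
      AnalyticAt ℂ (fun t => (((expUnit (I • Λ t x) * U x)⁻¹ : 𝔸ˣ) : 𝔸)) t₀ := by
  have h : AnalyticAt ℂ (fun t => I • Λ t x) t₀ := (hΛ x).fun_const_smul
  refine ⟨?_, ?_⟩
  · simp only [Units.val_mul, val_expUnit]
    exact ((exp_analytic _).fun_comp_of_eq h rfl).fun_mul analyticAt_const
  · simp only [mul_inv_rev, Units.val_mul, val_inv_expUnit, val_expUnit]
    exact analyticAt_const.fun_mul ((exp_analytic _).fun_comp_of_eq h.neg rfl)

/-- **The averages `(e^{iΛ(t)}U)‾ˡ(y)` of (3.193) are analytic in `t`** (and so are their inverses), `l ≤ j`, at every `t₀` where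
`e^{iΛ(t₀)}U` satisfies the log-domain condition below level `j`. [cite: Balaban1985BackgroundPropagators, (3.193) p.433; Balaban1985Averaging, (208) p.50] -/
theorem analyticAt_uavg_pert {Λ : E → Site d → 𝔸} {t₀ : E} (hΛ : ∀ x : Site d, AnalyticAt ℂ (fun t => Λ t x) t₀)
    (U : Site d → 𝔸ˣ) {j : ℕ} (hdom : LogDom L (fun x => expUnit (I • Λ t₀ x) * U x) j) :
    ∀ l ≤ j, ∀ y : Site d,
      AnalyticAt ℂ (fun t => ((uavg L 1 (fun x => expUnit (I • Λ t x) * U x) l y : 𝔸ˣ) : 𝔸)) t₀ ∧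
        AnalyticAt ℂ (fun t => (((uavg L 1 (fun x => expUnit (I • Λ t x) * U x) l y)⁻¹ : 𝔸ˣ) : 𝔸)) t₀ :=
  analyticAt_uavg_one L (G := fun t x => expUnit (I • Λ t x) * U x) (analyticAt_site_pert hΛ U) hdom

/-! ## §3 (3.193): `Q_j(U, A)` is analytic in `A` -/

/-- **(3.193) IS ANALYTIC IN `A`, along any analytic family.**  For `A = Λ(t)` depending analytically on `t ∈ E` sitewise, a background
`U` (arbitrary units), a level `j` and a point `y`: if at `t₀` the chiral configuration `e^{iΛ(t₀)}U` satisfies the log-domain condition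
below level `j` and the ratio `(e^{iΛ(t₀)}U)‾ʲ(y)(Ūʲ(y))⁻¹` lies in the disc `|W − 1| < 1` of the series logarithm (21), then
`t ↦ Q_j(U, Λ(t))(y) = (1/i) log (e^{iΛ(t)}U)‾ʲ(y)(Ūʲ(y))⁻¹` is analytic at `t₀` (`MatrixLog.analyticAt_mlog` ∘ `analyticAt_uavg_pert`;
the factor `(Ūʲ(y))⁻¹` does not depend on `t`). [cite: Balaban1985BackgroundPropagators, (3.193) p.433; Balaban1985Averaging, (208) p.50, (21) p.21] -/
theorem analyticAt_Qj_family {Λ : E → Site d → 𝔸} {t₀ : E} (hΛ : ∀ x : Site d, AnalyticAt ℂ (fun t => Λ t x) t₀)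
    (U : Site d → 𝔸ˣ) {j : ℕ} (hdom : LogDom L (fun x => expUnit (I • Λ t₀ x) * U x) j) (y : Site d)
    (hQ : ‖(((uavg L 1 (fun x => expUnit (I • Λ t₀ x) * U x) j y * (uavg L 1 U j y)⁻¹ : 𝔸ˣ)) : 𝔸) - 1‖ < 1) :
    AnalyticAt ℂ (fun t => Qj L U (Λ t) j y) t₀ := by
  have hU := (analyticAt_uavg_pert L hΛ U hdom j le_rfl y).1
  have hR : AnalyticAt ℂ
      (fun t => (((uavg L 1 (fun x => expUnit (I • Λ t x) * U x) j y * (uavg L 1 U j y)⁻¹ : 𝔸ˣ)) : 𝔸)) t₀ := by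
    simp only [Units.val_mul]
    exact hU.fun_mul analyticAt_const
  have e : (fun t => Qj L U (Λ t) j y) = fun t => (I⁻¹ : ℂ) •
      mlog (((uavg L 1 (fun x => expUnit (I • Λ t x) * U x) j y * (uavg L 1 U j y)⁻¹ : 𝔸ˣ)) : 𝔸) :=
    funext fun t => Qj_apply L U (Λ t) j y
  rw [e]
  exact ((analyticAt_mlog hQ).fun_comp_of_eq hR rfl).fun_const_smul

/-- **(3.193) AROUND `A = 0`** — the expansion point of (3.194): for an analytic family with `Λ(t₀) = 0` the configuration at `t₀`
is the background `U` itself and the ratio is `1`, so the log-domain condition `LogDom L U j` on `U` ALONE (the hypothesis of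
`B9Eq3194Derivative.hasDerivAt_Qj`) makes `t ↦ Q_j(U, Λ(t))(y)` analytic at `t₀`. [cite: Balaban1985BackgroundPropagators, (3.193)–(3.194) p.433] -/
theorem analyticAt_Qj_of_eq_zero {Λ : E → Site d → 𝔸} {t₀ : E} (hΛ : ∀ x : Site d, AnalyticAt ℂ (fun t => Λ t x) t₀)
    (h0 : Λ t₀ = 0) {U : Site d → 𝔸ˣ} {j : ℕ} (hdom : LogDom L U j) (y : Site d) :
    AnalyticAt ℂ (fun t => Qj L U (Λ t) j y) t₀ := by
  have hU0 : (fun x => expUnit (I • Λ t₀ x) * U x) = U := by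
    funext x
    rw [h0, Pi.zero_apply, smul_zero, expUnit_zero, one_mul]
  have hdom' : LogDom L (fun x => expUnit (I • Λ t₀ x) * U x) j := by
    rw [hU0]
    exact hdom
  have hQ : ‖(((uavg L 1 (fun x => expUnit (I • Λ t₀ x) * U x) j y * (uavg L 1 U j y)⁻¹ : 𝔸ˣ)) : 𝔸) - 1‖ < 1 := by
    rw [hU0, mul_inv_cancel, Units.val_one, sub_self, norm_zero]
    exact one_pos
  exact analyticAt_Qj_family L hΛ U hdom' y hQ

/-- **The complex line of (3.194) is an analytic germ**: under `LogDom L U j`, `t ↦ Q_j(U, tA)(y)` — the curve differentiated at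
`t = 0` by `B9Eq3194Derivative.hasDerivAt_Qj`, whose derivative `linQj L U A j y` is (3.194)'s `Q_j(U)A` — is analytic at `t = 0`
for every direction `A`. [cite: Balaban1985BackgroundPropagators, (3.193)–(3.194) p.433] -/
theorem analyticAt_Qj_smul_zero {U : Site d → 𝔸ˣ} {j : ℕ} (hdom : LogDom L U j) (A : Site d → 𝔸) (y : Site d) :
    AnalyticAt ℂ (fun t : ℂ => Qj L U (t • A) j y) 0 := by
  have hΛ : ∀ x : Site d, AnalyticAt ℂ (fun t : ℂ => (t • A) x) 0 := fun x => by
    simp only [Pi.smul_apply]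
    exact analyticAt_id.smul analyticAt_const
  exact analyticAt_Qj_of_eq_zero L (Λ := fun t : ℂ => t • A) hΛ (zero_smul ℂ A) hdom y

/-- The same under the (167)-regularity of `U` used by `B9Eq3194Smallness.norm_F2_le`: `Cond167 L 1 U j α η` with `αLʲη < 1`
(`B9Eq3194Derivative.logDom_of_cond167`). [cite: Balaban1985BackgroundPropagators, (3.193)–(3.194) p.433; Balaban1985Averaging, (167) p.44] -/
theorem analyticAt_Qj_smul_zero_of_cond167 {U : Site d → 𝔸ˣ} {j : ℕ} {α η : ℝ} (h167 : Cond167 L 1 U j α η)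
    (hL : 1 ≤ L) (hα : 0 ≤ α) (hη : 0 ≤ η) (hs : α * (L : ℝ) ^ j * η < 1) (A : Site d → 𝔸) (y : Site d) :
    AnalyticAt ℂ (fun t : ℂ => Qj L U (t • A) j y) 0 :=
  analyticAt_Qj_smul_zero L (logDom_of_cond167 L h167 hL hα hη hs) A y

end Literature.MathematicalPhysics.QuantumFieldTheory.Balaban1983to89.B9Eq3193Analytic
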